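import Summits.ResolutionOfSingularities.ResolutionOfSingularities.Theorems.HilbertSamuelEliminationSigmaMaxModificationsCorridor3WLadderSegmentsHEmp
import Literature.AlgebraicGeometry.Resolution.BlowupOffCentre
import HarnessLib

/-!
# [OURS · L1 W4.2] (H-emp) WITHIN THE UNIT FROM THE GEOMETRY AT THE BIRTH STAGES ONLY: the dichotomy and the regularity of the near locus
# propagate through WAITING steps (a blow-up is an isomorphism near a near locus it does not meet)
# (crux `SigmaMaxModifications` stmt-ResolutionOfSingularities-18506; conjunct `SigmaMaxModificationsCorridor3` stmt-…-19249; line `w_ladder`; RECOGNITION (R5))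

Stub worker res-L1-w42-stub-1 (gen 4). Helper file `--supports stmt-ResolutionOfSingularities-19249 --as helper`; kernel only, FACT-FREE, no new
definition. Strengthening of `…SegmentsHEmp` (p527103): there the geometric inputs (Dich_n) «`N_n` infinite irreducible, or finite closed points»
and (RegN_n) «infinite `N_n` regular (reduced)» were asked at EVERY stage `0 < n < M` of the unit. Here they are asked only at the BIRTH stages
`n + 1` following a GENUINE step `n` (the marked point blown up) — i.e. exactly where CJS's analysis of the near points of a permissible blow-up
takes place (Lemma 6.33, Def. 6.34, p. 105) — and PROPAGATED through the waiting steps: at a waiting step the centre misses `N_n` (by the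
invariant), so `N_{n+1} = π⁻¹(N_n)` (`nearLocus_succ_eq_preimage`, `H` unchanged off the centre) and the blow-down is an isomorphism near it:
irreducibility, (in)finiteness, closedness of points and regularity of the reduced subscheme transfer (tree `IsBlowup.isIrreducible_preimage_of_disjoint`,
`IsBlowup.isRegular_subscheme_vanishingIdeal_preimage`).

* `Seg.dich_regN_of_births` — (Dich_n) ∧ (RegN_n) for all `0 < n < M` from the birth-stage hypotheses (so every theorem of `…SegmentsHEmp`,
  `…SegmentsExtractU`, `…SegmentsCentreNear` applies with birth-stage inputs); `Seg.hEmp_of_births` — `(locTower b).C n = ∅` at waiting `n < M`.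

OURS bookkeeping; NOT a statement of the manuscript [Hironaka2017] nor of [CossartJannsenSaito2020]. AI-written; AI review is weaker than expert
review.

References: V. Cossart, U. Jannsen, S. Saito, LNM 2270 (2020), Rem. 6.29 (1), Lemma 6.33, Def. 6.34, Def. 6.38, p. 105 [CossartJannsenSaito2020];
U. Görtz, T. Wedhorn, *Algebraic Geometry I*, Prop. 13.91 (3) [GortzWedhorn2020].
-/

noncomputable section

set_option linter.dupNamespace false -- namespace `…Corridor3.Moving` re-enters `…Corridor3` (module convention of the Moving files)

open CategoryTheory AlgebraicGeometry TopologicalSpace Topology IsLocalRing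
open Literature.AlgebraicGeometry.Resolution Literature.RingTheory.HilbertSamuel
open Literature.AlgebraicGeometry.CossartJannsenSaito2020
open Summit.ResolutionOfSingularities.ResolutionOfSingularities.Theorems.CampaignW42
open Summit.ResolutionOfSingularities.ResolutionOfSingularities.Theorems.SigmaMaxModificationsCorridor3.Helpers

namespace Summit.ResolutionOfSingularities.ResolutionOfSingularities.Theorems.SigmaMaxModificationsCorridor3.Moving.Seg

variable {R : ∀ S : Scheme.{0}, CentreSeq S → Prop} {N : ℕ} {ν : ℕ → ℕ} {k : Type} [Field k]
  {c : ℕ → MarkedStage.{0}} (hc : ∀ n, CanonicalNearStep R N ν (c n) (c (n + 1))) (hRf : OracleFunctional R) (hRa : OracleAdmissible R)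
  (hν : ν ≠ iterPSum N Phi) (h0 : Helpers.CycleInv k N ν (c 0))
  {p : ℕ} {X : Scheme.{0}} [IsLocallyNoetherian X] {x : X} (hX : IsMaximalOrigin p N ν X x)
  (hreach : Reaches R N ν (MarkedStage.init X x) (c 0))

/-! ## §1. A waiting step is an isomorphism near the near locus -/

/-- **At a step whose centre misses the near locus, `N_{n+1} = π⁻¹(N_n)`** (`H` is unchanged off the centre; `ν` maximal).
[cite: CossartJannsenSaito2020, Def. 6.34 (ii), Thm. 3.10 (1)] -/
theorem nearLocus_succ_eq_preimage (b n : ℕ)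
    (hdisj : (upTower hc hRa hν h0 b).C n ∩ (upTower hc hRa hν h0 b).nearLocus N (c b).pt n = ∅) :
    (upTower hc hRa hν h0 b).nearLocus N (c b).pt (n + 1) = ((upTower hc hRa hν h0 b).π n).base ⁻¹' (upTower hc hRa hν h0 b).nearLocus N (c b).pt n := by
  haveI : IsLocallyNoetherian ((upTower hc hRa hν h0 b).X n) := (upTower hc hRa hν h0 b).ln n
  apply Set.Subset.antisymm
  · intro z hz
    exact image_nearLocus_succ_subset hc hRa hν h0 b n ⟨z, hz, rfl⟩
  · intro z hz
    have hzC : ((upTower hc hRa hν h0 b).π n).base z ∉ (upTower hc hRa hν h0 b).C n := fun h => by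
      have : ((upTower hc hRa hν h0 b).π n).base z ∈ (upTower hc hRa hν h0 b).C n ∩ (upTower hc hRa hν h0 b).nearLocus N (c b).pt n := ⟨h, hz⟩
      rw [hdisj] at this; exact this
    exact BlowupTowerNear.mem_nearLocus_succ_of_near _ (keySetting_upTower hc hRa hν h0 b) (isPermissible_centreIdeal_upTower hc hRa hν h0 b) _ n
      hz (((upTower hc hRa hν h0 b).isBlowup n).hsFun_eq_of_not_mem hzC N)

/-- Points off the centre are in the range of the blow-down, on which it is injective over the complement of the centre. [cite: GortzWedhorn2020, Prop. 13.91 (3)] -/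
theorem exists_unique_preimage_of_not_mem_C (T : BlowupTower.{0}) (n : ℕ) {y : T.X n} (hy : y ∉ T.C n) :
    ∃ z : T.X (n + 1), (T.π n).base z = y ∧ ∀ z' : T.X (n + 1), (T.π n).base z' = y → z' = z := by
  have hy' : y ∈ ((Scheme.IdealSheafData.vanishingIdeal (⟨T.C n, T.isClosed_C n⟩ : Closeds (T.X n))).support : Set (T.X n))ᶜ := by
    rw [Scheme.IdealSheafData.coe_support_vanishingIdeal]; exact hy
  haveI : IsIso (T.π n ∣_ centreCompl (Scheme.IdealSheafData.vanishingIdeal ⟨T.C n, T.isClosed_C n⟩)) := (T.isBlowup n).isIso_compl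
  haveI hoi : IsOpenImmersion ((T.π n ⁻¹ᵁ centreCompl (Scheme.IdealSheafData.vanishingIdeal ⟨T.C n, T.isClosed_C n⟩)).ι ≫ T.π n) :=
    (T.isBlowup n).isOpenImmersion_preimage_compl_ι
  obtain ⟨w, hw⟩ := (T.π n ∣_ centreCompl (Scheme.IdealSheafData.vanishingIdeal ⟨T.C n, T.isClosed_C n⟩)).homeomorph.surjective ⟨y, hy'⟩
  have hwy : (T.π n).base w.1 = y := by
    have := congrArg Subtype.val hw
    simpa [morphismRestrict_base_coe] using this
  refine ⟨w.1, hwy, fun z' hz' => ?_⟩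
  have hz'U : z' ∈ T.π n ⁻¹ᵁ centreCompl (Scheme.IdealSheafData.vanishingIdeal ⟨T.C n, T.isClosed_C n⟩) := by
    show (T.π n).base z' ∈ ((Scheme.IdealSheafData.vanishingIdeal (⟨T.C n, T.isClosed_C n⟩ : Closeds (T.X n))).support : Set (T.X n))ᶜ
    rw [hz']; exact hy'
  have hinj := hoi.base_open.injective
  have : (⟨z', hz'U⟩ : ↥(T.π n ⁻¹ᵁ centreCompl (Scheme.IdealSheafData.vanishingIdeal ⟨T.C n, T.isClosed_C n⟩))) = w := by
    apply hinj
    show ((T.π n ⁻¹ᵁ _).ι ≫ T.π n).base ⟨z', hz'U⟩ = ((T.π n ⁻¹ᵁ _).ι ≫ T.π n).base w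
    rw [Scheme.Hom.comp_apply, Scheme.Hom.comp_apply]
    show (T.π n).base z' = (T.π n).base w.1
    rw [hz', hwy]
  exact congrArg Subtype.val this

include hX hreach in
/-- **(Dich) PROPAGATES THROUGH A STEP WHOSE CENTRE MISSES THE NEAR LOCUS.** [cite: GortzWedhorn2020, Prop. 13.91 (3)] -/
theorem dich_succ_of_disjoint (b n : ℕ)
    (hdisj : (upTower hc hRa hν h0 b).C n ∩ (upTower hc hRa hν h0 b).nearLocus N (c b).pt n = ∅)
    (hD : (((upTower hc hRa hν h0 b).nearLocus N (c b).pt n).Infinite ∧ IsIrreducible ((upTower hc hRa hν h0 b).nearLocus N (c b).pt n)) ∨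
      (((upTower hc hRa hν h0 b).nearLocus N (c b).pt n).Finite ∧
        ∀ y ∈ (upTower hc hRa hν h0 b).nearLocus N (c b).pt n, IsClosed ({y} : Set (c (b + n)).W))) :
    (((upTower hc hRa hν h0 b).nearLocus N (c b).pt (n + 1)).Infinite ∧ IsIrreducible ((upTower hc hRa hν h0 b).nearLocus N (c b).pt (n + 1))) ∨
      (((upTower hc hRa hν h0 b).nearLocus N (c b).pt (n + 1)).Finite ∧
        ∀ y ∈ (upTower hc hRa hν h0 b).nearLocus N (c b).pt (n + 1), IsClosed ({y} : Set (c (b + (n + 1))).W)) := by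
  have heq := nearLocus_succ_eq_preimage hc hRa hν h0 b n hdisj
  have hout : ∀ y ∈ (upTower hc hRa hν h0 b).nearLocus N (c b).pt n, y ∉ (upTower hc hRa hν h0 b).C n := fun y hy h => by
    have : y ∈ (upTower hc hRa hν h0 b).C n ∩ (upTower hc hRa hν h0 b).nearLocus N (c b).pt n := ⟨h, hy⟩
    rw [hdisj] at this; exact this
  have hdisj' : Disjoint (((⟨(upTower hc hRa hν h0 b).nearLocus N (c b).pt n, isClosed_nearLocus hc hRa hν h0 hX hreach b n⟩ :
      Closeds ((upTower hc hRa hν h0 b).X n)) : Set ((upTower hc hRa hν h0 b).X n)))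
      ((Scheme.IdealSheafData.vanishingIdeal ⟨(upTower hc hRa hν h0 b).C n, (upTower hc hRa hν h0 b).isClosed_C n⟩).support :
        Set ((upTower hc hRa hν h0 b).X n)) := by
    rw [Scheme.IdealSheafData.coe_support_vanishingIdeal]
    exact Set.disjoint_left.mpr fun y hy h => hout y hy h
  rcases hD with ⟨hinf, hirr⟩ | ⟨hfin, hcl⟩
  · refine Or.inl ⟨?_, ?_⟩
    · rw [heq]
      refine hinf.preimage fun y hy => ?_
      obtain ⟨z, hz, -⟩ := exists_unique_preimage_of_not_mem_C (upTower hc hRa hν h0 b) n (hout y hy)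
      exact ⟨z, hz⟩
    · rw [heq]
      exact ((upTower hc hRa hν h0 b).isBlowup n).isIrreducible_preimage_of_disjoint _ hdisj' hirr
  · refine Or.inr ⟨?_, fun z hz => ?_⟩
    · rw [heq]
      refine hfin.preimage fun z₁ hz₁ z₂ hz₂ h => ?_
      obtain ⟨z, -, huniq⟩ := exists_unique_preimage_of_not_mem_C (upTower hc hRa hν h0 b) n (hout _ hz₂)
      exact (huniq z₁ h).trans (huniq z₂ rfl).symm
    · have hz' : ((upTower hc hRa hν h0 b).π n).base z ∈ (upTower hc hRa hν h0 b).nearLocus N (c b).pt n := by rw [heq] at hz; exact hz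
      obtain ⟨w, -, huniq⟩ := exists_unique_preimage_of_not_mem_C (upTower hc hRa hν h0 b) n (hout _ hz')
      have hpre : (((upTower hc hRa hν h0 b).π n).base ⁻¹' ({((upTower hc hRa hν h0 b).π n).base z} : Set (c (b + n)).W) : Set (c (b + (n + 1))).W) =
          ({z} : Set (c (b + (n + 1))).W) :=
        Set.eq_singleton_iff_unique_mem.mpr ⟨rfl, fun z' h => (huniq z' h).trans (huniq z rfl).symm⟩
      have hclz : IsClosed (((upTower hc hRa hν h0 b).π n).base ⁻¹' ({((upTower hc hRa hν h0 b).π n).base z} : Set (c (b + n)).W) :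
          Set (c (b + (n + 1))).W) :=
        (hcl _ hz').preimage ((upTower hc hRa hν h0 b).π n).continuous
      rw [hpre] at hclz
      exact hclz

include hX hreach in
/-- **(RegN) PROPAGATES THROUGH A STEP WHOSE CENTRE MISSES THE NEAR LOCUS.** [cite: BierstoneGrigorievMilmanWlodarczyk2011, Thm. 8.0.5] -/
theorem regN_succ_of_disjoint (b n : ℕ)
    (hdisj : (upTower hc hRa hν h0 b).C n ∩ (upTower hc hRa hν h0 b).nearLocus N (c b).pt n = ∅)
    (hR : ∀ h : IsClosed ((upTower hc hRa hν h0 b).nearLocus N (c b).pt n),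
      Scheme.IsRegular (Scheme.IdealSheafData.vanishingIdeal ⟨(upTower hc hRa hν h0 b).nearLocus N (c b).pt n, h⟩).subscheme)
    (h' : IsClosed ((upTower hc hRa hν h0 b).nearLocus N (c b).pt (n + 1))) :
    Scheme.IsRegular (Scheme.IdealSheafData.vanishingIdeal ⟨(upTower hc hRa hν h0 b).nearLocus N (c b).pt (n + 1), h'⟩).subscheme := by
  haveI : IsLocallyNoetherian ((upTower hc hRa hν h0 b).X n) := (upTower hc hRa hν h0 b).ln n
  have heq := nearLocus_succ_eq_preimage hc hRa hν h0 b n hdisj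
  have hdisj' : Disjoint (((⟨(upTower hc hRa hν h0 b).nearLocus N (c b).pt n, isClosed_nearLocus hc hRa hν h0 hX hreach b n⟩ :
      Closeds ((upTower hc hRa hν h0 b).X n)) : Set ((upTower hc hRa hν h0 b).X n)))
      ((Scheme.IdealSheafData.vanishingIdeal ⟨(upTower hc hRa hν h0 b).C n, (upTower hc hRa hν h0 b).isClosed_C n⟩).support :
        Set ((upTower hc hRa hν h0 b).X n)) := by
    rw [Scheme.IdealSheafData.coe_support_vanishingIdeal]
    refine Set.disjoint_left.mpr fun y hy h => ?_
    have : y ∈ (upTower hc hRa hν h0 b).C n ∩ (upTower hc hRa hν h0 b).nearLocus N (c b).pt n := ⟨h, hy⟩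
    rw [hdisj] at this; exact this
  have key := ((upTower hc hRa hν h0 b).isBlowup n).isRegular_subscheme_vanishingIdeal_preimage _ hdisj' (hR _)
  have hcl : (⟨(upTower hc hRa hν h0 b).nearLocus N (c b).pt (n + 1), h'⟩ : Closeds ((upTower hc hRa hν h0 b).X (n + 1))) =
      (⟨(upTower hc hRa hν h0 b).nearLocus N (c b).pt n, isClosed_nearLocus hc hRa hν h0 hX hreach b n⟩ :
        Closeds ((upTower hc hRa hν h0 b).X n)).preimage ((upTower hc hRa hν h0 b).π n).continuous := by
    apply Closeds.ext
    rw [Closeds.coe_preimage]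
    exact heq
  rw [hcl]
  exact key

/-! ## §2. The invariant with the geometric inputs carried along, from the birth stages -/

include hRf hX hreach in
/-- **THE INVARIANT OF THE UNIT FROM BIRTH-STAGE GEOMETRY.** Base `b` blown up at a marked point isolated in the Hilbert–Samuel locus; (Dich)
and (RegN) assumed only at the stages `n + 1 < M` following a GENUINE step `n`. Then at every stage `0 < n < M`: one label inside `N_n`,
replay avoidance off `N_n`, (Dich_n) and (RegN_n). [cite: CossartJannsenSaito2020, Rem. 6.29 (1), Def. 6.38, Lemma 6.33] -/
theorem invariant_of_births (b : ℕ) (hb : (c b).IsBlownUp R N ν) (hiso : Iso N (c b)) (M : ℕ)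
    (hDichB : ∀ n, n + 1 < M → (c (b + n)).IsBlownUp R N ν →
      (((upTower hc hRa hν h0 b).nearLocus N (c b).pt (n + 1)).Infinite ∧ IsIrreducible ((upTower hc hRa hν h0 b).nearLocus N (c b).pt (n + 1))) ∨
      (((upTower hc hRa hν h0 b).nearLocus N (c b).pt (n + 1)).Finite ∧
        ∀ y ∈ (upTower hc hRa hν h0 b).nearLocus N (c b).pt (n + 1), IsClosed ({y} : Set (c (b + (n + 1))).W)))
    (hRegB : ∀ n, n + 1 < M → (c (b + n)).IsBlownUp R N ν → ((upTower hc hRa hν h0 b).nearLocus N (c b).pt (n + 1)).Infinite →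
      ∀ h : IsClosed ((upTower hc hRa hν h0 b).nearLocus N (c b).pt (n + 1)),
        Scheme.IsRegular (Scheme.IdealSheafData.vanishingIdeal ⟨(upTower hc hRa hν h0 b).nearLocus N (c b).pt (n + 1), h⟩).subscheme) :
    ∀ n, 0 < n → n < M →
      (∀ Z₁ ∈ componentsIn (Scheme.hsStratum (c (b + n)).W N ν), ∀ Z₂ ∈ componentsIn (Scheme.hsStratum (c (b + n)).W N ν),
        Z₁ ⊆ (upTower hc hRa hν h0 b).nearLocus N (c b).pt n → Z₂ ⊆ (upTower hc hRa hν h0 b).nearLocus N (c b).pt n →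
          (c (b + n)).L.label Z₁ = (c (b + n)).L.label Z₂) ∧
      (∀ Q, (c (b + n)).P = some Q → Q.rest.CentresOver (Q.hom.base ⁻¹' ((upTower hc hRa hν h0 b).nearLocus N (c b).pt n)ᶜ)) ∧
      ((((upTower hc hRa hν h0 b).nearLocus N (c b).pt n).Infinite ∧ IsIrreducible ((upTower hc hRa hν h0 b).nearLocus N (c b).pt n)) ∨
        (((upTower hc hRa hν h0 b).nearLocus N (c b).pt n).Finite ∧
          ∀ y ∈ (upTower hc hRa hν h0 b).nearLocus N (c b).pt n, IsClosed ({y} : Set (c (b + n)).W))) ∧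
      (((upTower hc hRa hν h0 b).nearLocus N (c b).pt n).Infinite →
        ∀ h : IsClosed ((upTower hc hRa hν h0 b).nearLocus N (c b).pt n),
          Scheme.IsRegular (Scheme.IdealSheafData.vanishingIdeal ⟨(upTower hc hRa hν h0 b).nearLocus N (c b).pt n, h⟩).subscheme) := by
  obtain ⟨k', _, _, hg⟩ := hX.exists_stateGood_of_reaches hRa hν (reaches_chain hreach hc b)
  have hU := stratumIsolated_of_iso hg hiso
  obtain ⟨hN0, hD0, hone0⟩ := nearLocus_base hc hRa hν h0 hX hreach b
  intro n
  induction n with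
  | zero => intro h; exact absurd h (lt_irrefl 0)
  | succ n ih =>
    intro _ hlt
    rcases Nat.eq_zero_or_pos n with rfl | hpos
    · -- `n + 1 = 1`: the base step is genuine, so stage `1` is a birth stage
      have hD1 := hDichB 0 hlt hb
      refine ⟨oneLabel_succ hc hRa hν h0 hX hreach b hU 0 hD0 hD1 hone0, fun Q hQ => ?_, hD1, hRegB 0 hlt hb⟩
      have hnone : (c (b + 1)).P = none := P_succ_eq_none_of_isBlownUp_of_iso hc hRf hRa hν hX hreach b hb hiso
      exact absurd (hnone.symm.trans hQ) (by simp)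
    · obtain ⟨hone, hRA, hDn, hRn⟩ := ih hpos (Nat.lt_of_succ_lt hlt)
      have hregT := fun j h z hz => part_regular_along_nearLocus hc hRa hν h0 hX hreach b hU n hone hDn hRn j h z hz
      -- (Dich)/(RegN) at `n + 1`: from the births at a genuine step, by transport at a waiting step
      have hnext : ((((upTower hc hRa hν h0 b).nearLocus N (c b).pt (n + 1)).Infinite ∧
            IsIrreducible ((upTower hc hRa hν h0 b).nearLocus N (c b).pt (n + 1))) ∨
          (((upTower hc hRa hν h0 b).nearLocus N (c b).pt (n + 1)).Finite ∧
            ∀ y ∈ (upTower hc hRa hν h0 b).nearLocus N (c b).pt (n + 1), IsClosed ({y} : Set (c (b + (n + 1))).W))) ∧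
          (((upTower hc hRa hν h0 b).nearLocus N (c b).pt (n + 1)).Infinite →
            ∀ h : IsClosed ((upTower hc hRa hν h0 b).nearLocus N (c b).pt (n + 1)),
              Scheme.IsRegular (Scheme.IdealSheafData.vanishingIdeal ⟨(upTower hc hRa hν h0 b).nearLocus N (c b).pt (n + 1), h⟩).subscheme) := by
        by_cases hBn : (c (b + n)).IsBlownUp R N ν
        · exact ⟨hDichB n hlt hBn, hRegB n hlt hBn⟩
        · -- waiting: the centre misses `N_n`
          obtain ⟨P', hcs⟩ := Helpers.isCanonicalStep_chainCentre (shiftStep hc b) n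
          have hdisj : (upTower hc hRa hν h0 b).C n ∩ (upTower hc hRa hν h0 b).nearLocus N (c b).pt n = ∅ := by
            by_contra hne
            obtain ⟨ℓ, hℓ⟩ := exists_part_of_centre_meets hRa hRA (fun _ j h _ z hz => hregT j h z hz) hcs (Set.nonempty_iff_ne_empty.mpr hne)
            have hmeet : ((c (b + n)).L.part (Scheme.hsStratum (c (b + n)).W N ν) ℓ ∩ (upTower hc hRa hν h0 b).nearLocus N (c b).pt n).Nonempty := by
              rw [← hℓ]; exact Set.nonempty_iff_ne_empty.mpr hne
            have hsub := nearLocus_subset_part_of_meets hc hRa hν h0 hX hreach b hU n hone hmeet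
            rw [← hℓ] at hsub
            exact hBn ⟨_, P', hcs, hsub (pt_mem_nearLocus hc hRa hν h0 hX hreach b n)⟩
          refine ⟨dich_succ_of_disjoint hc hRa hν h0 hX hreach b n hdisj hDn, fun hinf h' => ?_⟩
          have hinfn : ((upTower hc hRa hν h0 b).nearLocus N (c b).pt n).Infinite := by
            intro hfin
            rw [nearLocus_succ_eq_preimage hc hRa hν h0 b n hdisj] at hinf
            refine hinf (hfin.preimage fun z₁ _ z₂ hz₂ h => ?_)
            have hout : ((upTower hc hRa hν h0 b).π n).base z₂ ∉ (upTower hc hRa hν h0 b).C n := fun hC => by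
              have : _ ∈ (upTower hc hRa hν h0 b).C n ∩ (upTower hc hRa hν h0 b).nearLocus N (c b).pt n := ⟨hC, hz₂⟩
              rw [hdisj] at this; exact this
            obtain ⟨z, -, huniq⟩ := exists_unique_preimage_of_not_mem_C (upTower hc hRa hν h0 b) n hout
            exact (huniq z₁ h).trans (huniq z₂ rfl).symm
          exact regN_succ_of_disjoint hc hRa hν h0 hX hreach b n hdisj (hRn hinfn) h'
      refine ⟨oneLabel_succ hc hRa hν h0 hX hreach b hU n hDn hnext.1 hone, ?_, hnext.1, hnext.2⟩
      have hf : StepProjection R N ν (c (b + n)) (c (b + (n + 1))) ((upTower hc hRa hν h0 b).π n) :=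
        Helpers.stepProjection_chainProj (shiftStep hc b) n
      exact replayAvoid_step hRa hf (image_nearLocus_succ_subset hc hRa hν h0 b n) hRA fun _ j h _ z hz => hregT j h z hz

include hRf hX hreach in
/-- **(Dich) and (RegN) at every stage of the unit from the birth stages** — the inputs of `…SegmentsHEmp` / `…SegmentsExtractU` /
`…SegmentsCentreNear` discharged from birth-stage geometry. [cite: CossartJannsenSaito2020, Lemma 6.33, Def. 6.34, p. 105] -/
theorem dich_regN_of_births (b : ℕ) (hb : (c b).IsBlownUp R N ν) (hiso : Iso N (c b)) (M : ℕ)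
    (hDichB : ∀ n, n + 1 < M → (c (b + n)).IsBlownUp R N ν →
      (((upTower hc hRa hν h0 b).nearLocus N (c b).pt (n + 1)).Infinite ∧ IsIrreducible ((upTower hc hRa hν h0 b).nearLocus N (c b).pt (n + 1))) ∨
      (((upTower hc hRa hν h0 b).nearLocus N (c b).pt (n + 1)).Finite ∧
        ∀ y ∈ (upTower hc hRa hν h0 b).nearLocus N (c b).pt (n + 1), IsClosed ({y} : Set (c (b + (n + 1))).W)))
    (hRegB : ∀ n, n + 1 < M → (c (b + n)).IsBlownUp R N ν → ((upTower hc hRa hν h0 b).nearLocus N (c b).pt (n + 1)).Infinite →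
      ∀ h : IsClosed ((upTower hc hRa hν h0 b).nearLocus N (c b).pt (n + 1)),
        Scheme.IsRegular (Scheme.IdealSheafData.vanishingIdeal ⟨(upTower hc hRa hν h0 b).nearLocus N (c b).pt (n + 1), h⟩).subscheme) :
    (∀ n, 0 < n → n < M →
      (((upTower hc hRa hν h0 b).nearLocus N (c b).pt n).Infinite ∧ IsIrreducible ((upTower hc hRa hν h0 b).nearLocus N (c b).pt n)) ∨
      (((upTower hc hRa hν h0 b).nearLocus N (c b).pt n).Finite ∧
        ∀ y ∈ (upTower hc hRa hν h0 b).nearLocus N (c b).pt n, IsClosed ({y} : Set (c (b + n)).W))) ∧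
    (∀ n, 0 < n → n < M → ((upTower hc hRa hν h0 b).nearLocus N (c b).pt n).Infinite →
      ∀ h : IsClosed ((upTower hc hRa hν h0 b).nearLocus N (c b).pt n),
        Scheme.IsRegular (Scheme.IdealSheafData.vanishingIdeal ⟨(upTower hc hRa hν h0 b).nearLocus N (c b).pt n, h⟩).subscheme) :=
  ⟨fun n hn hM => (invariant_of_births hc hRf hRa hν h0 hX hreach b hb hiso M hDichB hRegB n hn hM).2.2.1,
    fun n hn hM => (invariant_of_births hc hRf hRa hν h0 hX hreach b hb hiso M hDichB hRegB n hn hM).2.2.2⟩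

include hRf hX hreach in
/-- **(H-emp) WITHIN THE UNIT FROM BIRTH-STAGE GEOMETRY**: for `n < M` not blown up, `(locTower b).C n = ∅`. [cite: CossartJannsenSaito2020, Def. 6.38 (iii), Rem. 6.29 (1)] -/
theorem locTower_C_eq_empty_of_births (b : ℕ) (hb : (c b).IsBlownUp R N ν) (hiso : Iso N (c b)) (M : ℕ)
    (hDichB : ∀ n, n + 1 < M → (c (b + n)).IsBlownUp R N ν →
      (((upTower hc hRa hν h0 b).nearLocus N (c b).pt (n + 1)).Infinite ∧ IsIrreducible ((upTower hc hRa hν h0 b).nearLocus N (c b).pt (n + 1))) ∨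
      (((upTower hc hRa hν h0 b).nearLocus N (c b).pt (n + 1)).Finite ∧
        ∀ y ∈ (upTower hc hRa hν h0 b).nearLocus N (c b).pt (n + 1), IsClosed ({y} : Set (c (b + (n + 1))).W)))
    (hRegB : ∀ n, n + 1 < M → (c (b + n)).IsBlownUp R N ν → ((upTower hc hRa hν h0 b).nearLocus N (c b).pt (n + 1)).Infinite →
      ∀ h : IsClosed ((upTower hc hRa hν h0 b).nearLocus N (c b).pt (n + 1)),
        Scheme.IsRegular (Scheme.IdealSheafData.vanishingIdeal ⟨(upTower hc hRa hν h0 b).nearLocus N (c b).pt (n + 1), h⟩).subscheme)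
    (n : ℕ) (hn : n < M) (hw : ¬ (c (b + n)).IsBlownUp R N ν) : (locTower hc hRa hν h0 b).C n = ∅ :=
  locTower_C_eq_empty_of_lt hc hRf hRa hν h0 hX hreach b hb hiso M (dich_regN_of_births hc hRf hRa hν h0 hX hreach b hb hiso M hDichB hRegB).1
    (dich_regN_of_births hc hRf hRa hν h0 hX hreach b hb hiso M hDichB hRegB).2 n hn hw

end Summit.ResolutionOfSingularities.ResolutionOfSingularities.Theorems.SigmaMaxModificationsCorridor3.Moving.Seg

end
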